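import Literature.AlgebraicGeometry.Resolution.SmoothUniformization
import Mathlib.RingTheory.Valuation.ValuationSubring
import Mathlib.RingTheory.LocalRing.ResidueField.Basic
import Mathlib.RingTheory.AlgebraicIndependent.Basic
import Mathlib.FieldTheory.Separable
import Mathlib.FieldTheory.IntermediateField.Adjoin.Defs
import HarnessLib

/-!
# Valued function fields inside an ambient valued field (Knaf–Kuhlmann 2005/2009, §§1–2)

Topic: `Literature/AlgebraicGeometry/Resolution`. Vocabulary for the second layer of the
decomposition of the named fact `KnafKuhlmann2009` (`LocalUniformization.lean`) along the
printed proof of Knaf–Kuhlmann 2009, Thm. 1.2 (§4.2 of arXiv:math/0702856): the valuation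
theoretic notions its ingredients (Thm. 1.1, Prop. 2.3, Prop. 3.2, Prop. 3.4 of that paper and
Knaf–Kuhlmann 2005, Thm. 1.1) are stated in.

## The ambient rendering

Knaf–Kuhlmann fix once and for all an extension `𝒫` of the place `P` of the function field
`F|K` to an algebraic (or separable-algebraic) closure and then move freely between subfields
`K ⊆ F₀ ⊆ F ⊆ 𝓕 ⊆ F̃`, their valuation rings `O_E = O_𝒫 ∩ E`, value groups `vE ≤ vF̃` and residue
fields `EP ≤ F̃𝒫` (§2.1: "when considering intermediate fields `K ⊆ M ⊆ F` of a valued field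
extension `(F|K, P)` we use `O_M := O_P ∩ M`"). We render this literally: everything lives in
ONE ambient valued field `(Ω, V)` — a field `Ω` with a valuation subring `V : ValuationSubring Ω`
—, "fields" are `Subfield Ω`, the valuation ring of `E` is `V ∩ E`, the value group of `E` is
the subgroup `v(Eˣ)` of `ValueGroup V` and the residue field of `E` is the subfield
`resField V E` of `IsLocalRing.ResidueField V`. Base rings of models are arbitrary commutative
rings `R` with `[Algebra R Ω]` (in practice `↥K`, `↥(V ∩ K)` for subfields `K`).

## Content (definitions, with the source's wording)

* `resField V E` — the residue field `EP = O_E / 𝔪_E` of the subfield `E`, as the subfield of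
  the residue field of `V` formed by the residues of the elements of `V ∩ E`.
* `FGOver K F`, `FiniteOver K F`, `FiniteSeparableOver K F`,
  `FinitePurelyInseparableOver K F`, `SeparablyGeneratedOver K F` — "`F|K` is a
  function field (finitely generated)", "finite", "finite separable", "finite purely
  inseparable", "separable" (= separably generated, for finitely generated extensions; Lang,
  *Algebra*, VIII §4) for subfields `K ≤ F` of `Ω`, via `Subfield.closure`.
* `IsValueTorsionOver V K F` — "`vF/vK` is a torsion group" (KK09, (S2) p. 2 and Thm. 1.1).
* `IsResiduallyAlgebraicOver V K F` — "`FP|KP` is algebraic" (ibid.).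
* `IsAbhyankarPlace V K F` — "`P` is an Abhyankar place of `F|K`": equality in Abhyankar's
  inequality `trdeg(F|K) ≥ trdeg(FP|KP) + dim_ℚ(vF/vK ⊗ ℚ)` (KK09 (1), KK05 (1)), rendered in
  the elementary equivalent form: there are `x₁,…,x_ρ ∈ Fˣ` whose values are ℤ-independent
  modulo `vK`, and `y₁,…,y_τ ∈ O_F` whose residues are algebraically independent over `KP`, such
  that `F` is algebraic over `K(x, y)`. (Such `x, y` are automatically algebraically independent
  over `K` — KK05 Thm. 2.1 = Bourbaki, *Alg. Comm.* VI §10.3 Thm. 1 —, so the last clause says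
  `ρ + τ = trdeg(F|K)`, i.e. `≥` and hence `=` in the inequality; conversely under equality a
  maximal such system is a transcendence basis of the finitely generated extension `F|K`.)
* `IsSmoothlyUniformizableIn R V E Z` — the ambient twin of `IsSmoothlyUniformizable`
  (`SmoothUniformization.lean`; KK09 §1 p. 2 and §3.1 p. 14): an affine `R`-model
  `A ⊆ V ∩ E` of `E` (finitely presented over `R`, `Frac A = E`), smooth over `R` at the centre
  `𝔪_V ∩ A`, with `Z ⊆ A_{𝔪_V ∩ A}`.

## Sources

* H. Knaf, F.-V. Kuhlmann, *Every place admits local uniformization in a finite extension of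
  the function field*, Adv. Math. 221 (2009) 428–453 = arXiv:math/0702856, §1 (pp. 2–3),
  §2.1 (pp. 6–7).
* H. Knaf, F.-V. Kuhlmann, *Abhyankar places admit local uniformization in any
  characteristic*, Ann. Sci. ÉNS 38 (2005) 833–846 = arXiv:math/0304159, §1 (inequality (1),
  Abhyankar places), Thm. 2.1 and Cor. 2.2.

## Rendering notes

* All predicates take the two subfields `K F : Subfield Ω`; `K ≤ F` is not part of the
  definitions (the facts using them assume it). A ground field `k` given as `[Algebra k Ω]`
  enters through `(algebraMap k Ω).fieldRange`.
* Values: `V.valuation : Valuation Ω (ValuationSubring.ValueGroup V)`; "`v a ∈ vK`" is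
  `∃ b ∈ K, V.valuation a = V.valuation b` (then `b ≠ 0` automatically when `a ≠ 0`).
* `z ∈ A_{𝔪_V ∩ A}` (for `A ⊆ V`) is `z = a / b` with `a, b ∈ A`, `V.valuation b = 1`.
-/

noncomputable section

namespace Literature.AlgebraicGeometry.Resolution

universe u

open IsLocalRing

variable {Ω : Type*} [Field Ω]

/-! ## Residue fields of subfields -/

/-- The **residue field of a subfield** `E ⊆ Ω` with respect to the valuation ring `V` of `Ω`:
the image of `V ∩ E` (the valuation ring `O_E = O_𝒫 ∩ E` of the restricted place) in the
residue field `V/𝔪_V`, i.e. `EP ⊆ Ω𝒫` (Knaf–Kuhlmann 2009, §2.1: "`FP := O_P/𝔪_P`",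
"`O_M := O_P ∩ M`"). It is a subfield: the inverse of a non-zero residue `aP`, `a ∈ O_E`, is
the residue of `a⁻¹ ∈ O_E`. [cite: KnafKuhlmann2009, Section 2.1 (pp. 6–7)] -/
def resField (V : ValuationSubring Ω) (E : Subfield Ω) : Subfield (ResidueField V) where
  toSubring := (E.toSubring.comap V.subtype).map (residue V)
  inv_mem' := by
    intro r hr
    change r ∈ (E.toSubring.comap V.subtype).map (residue V) at hr
    change r⁻¹ ∈ (E.toSubring.comap V.subtype).map (residue V)
    obtain ⟨a, ha, rfl⟩ := Subring.mem_map.mp hr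
    have haE : (a : Ω) ∈ E := Subring.mem_comap.mp ha
    by_cases hunit : IsUnit a
    · obtain ⟨u, rfl⟩ := hunit
      refine Subring.mem_map.mpr ⟨↑u⁻¹, ?_, ?_⟩
      · rw [Subring.mem_comap]
        have : ((↑u⁻¹ : V) : Ω) = ((u : V) : Ω)⁻¹ := by
          apply eq_inv_of_mul_eq_one_left
          rw [← V.coe_mul (↑u⁻¹) (u : V), Units.inv_mul, V.coe_one]
        show ((↑u⁻¹ : V) : Ω) ∈ E.toSubring
        rw [this]
        exact E.inv_mem haE
      · rw [map_units_inv]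
    · have h0 : residue V a = 0 := (residue_eq_zero_iff a).mpr
        ((IsLocalRing.mem_maximalIdeal a).mpr hunit)
      exact Subring.mem_map.mpr ⟨0, by simp, by simp [h0]⟩

/-- Membership in the residue field of a subfield: the residues of elements of `V ∩ E`.
[folklore] -/
theorem mem_resField_iff (V : ValuationSubring Ω) (E : Subfield Ω) (r : ResidueField V) :
    r ∈ resField V E ↔ ∃ a : V, (a : Ω) ∈ E ∧ residue V a = r := by
  change r ∈ ((E.toSubring.comap V.subtype).map (residue V)) ↔ _
  simp only [Subring.mem_map, Subring.mem_comap, ValuationSubring.coe_subtype]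
  rfl

/-- The residue of an element of `V ∩ E` lies in the residue field of `E`. [folklore] -/
theorem residue_mem_resField (V : ValuationSubring Ω) {E : Subfield Ω} (a : V) (ha : (a : Ω) ∈ E) :
    residue V a ∈ resField V E :=
  (mem_resField_iff V E _).mpr ⟨a, ha, rfl⟩

/-- `resField V` is monotone in the subfield. [folklore] -/
theorem resField_mono (V : ValuationSubring Ω) {E E' : Subfield Ω} (h : E ≤ E') :
    resField V E ≤ resField V E' := by
  intro r hr
  obtain ⟨a, ha, rfl⟩ := (mem_resField_iff V E r).mp hr
  exact residue_mem_resField V a (h ha)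

/-! ## Field extensions inside `Ω` -/

/-- `F|K` is **finitely generated** ("`F|K` is a function field"): `F = K(s)` for a finite
`s ⊆ Ω`. [folklore] -/
def FGOver (K F : Subfield Ω) : Prop :=
  ∃ s : Finset Ω, Subfield.closure ((K : Set Ω) ∪ s) = F

/-- `F|K` is **finite**: `F = K(s)` for a finite set `s` of elements algebraic over `K`.
[folklore] -/
def FiniteOver (K F : Subfield Ω) : Prop :=
  ∃ s : Finset Ω, (∀ x ∈ s, IsAlgebraic K x) ∧ Subfield.closure ((K : Set Ω) ∪ s) = F

/-- `F|K` is **finite separable**: `F = K(s)` for a finite set `s` of elements separable over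
`K`. [folklore] -/
def FiniteSeparableOver (K F : Subfield Ω) : Prop :=
  ∃ s : Finset Ω, (∀ x ∈ s, IsSeparable K x) ∧ Subfield.closure ((K : Set Ω) ∪ s) = F

/-- `F|K` is **finite purely inseparable**: `F = K(s)` for a finite set `s` of elements `x`
with `x ^ (p ^ n) ∈ K` for some `n`, `p` the exponential characteristic. [folklore] -/
def FinitePurelyInseparableOver (K F : Subfield Ω) : Prop :=
  ∃ s : Finset Ω, (∀ x ∈ s, ∃ n : ℕ, x ^ (ringExpChar Ω) ^ n ∈ K) ∧
    Subfield.closure ((K : Set Ω) ∪ s) = F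

/-- `F|K` is **separably generated** ("separable", for function fields: Lang, *Algebra*,
VIII §4, Cor. 4.4): there is a finite `t ⊆ F`, algebraically independent over `K`, with every
element of `F` separable algebraic over `K(t)` (a separating transcendence basis).
[folklore] -/
def SeparablyGeneratedOver (K F : Subfield Ω) : Prop :=
  ∃ t : Finset Ω, (t : Set Ω) ⊆ F ∧ AlgebraicIndependent K ((↑) : t → Ω) ∧
    ∀ x ∈ F, IsSeparable (IntermediateField.adjoin K (t : Set Ω)) x

/-! ## Value groups and residue fields of an extension `F|K` inside `(Ω, V)` -/

/-- **`vF/vK` is a torsion group** (Knaf–Kuhlmann 2009, (S2) p. 2; hypothesis of Thm. 1.1):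
every value of a non-zero element of `F` has a positive multiple in `vK`.
[cite: KnafKuhlmann2009, Section 1 (p. 2)] -/
def IsValueTorsionOver (V : ValuationSubring Ω) (K F : Subfield Ω) : Prop :=
  ∀ a ∈ F, a ≠ 0 → ∃ n : ℕ, n ≠ 0 ∧ ∃ b ∈ K, V.valuation (a ^ n) = V.valuation b

/-- **`FP|KP` is algebraic** (Knaf–Kuhlmann 2009, (S2) p. 2; hypothesis of Thm. 1.1): every
element of the residue field of `F` is algebraic over the residue field of `K`.
[cite: KnafKuhlmann2009, Section 1 (p. 2)] -/
def IsResiduallyAlgebraicOver (V : ValuationSubring Ω) (K F : Subfield Ω) : Prop :=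
  ∀ r ∈ resField V F, IsAlgebraic (resField V K) r

/-- **Abhyankar place** (Knaf–Kuhlmann 2009, p. 2; Knaf–Kuhlmann 2005, §1): `P` is an
Abhyankar place of `F|K` if equality holds in
`trdeg(F|K) ≥ trdeg(FP|KP) + dim_ℚ((vF/vK) ⊗ ℚ)`. Elementary rendering (module docstring):
there are `x : Fin ρ → F`, non-zero, whose values are ℤ-linearly independent modulo `vK`
(`∏ v(xᵢ)^{mᵢ} ∈ vK ⇒ m = 0`), and `y : Fin τ → V ∩ F` whose residues are algebraically
independent over `KP`, such that every element of `F` is algebraic over `K(x, y)` — by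
Knaf–Kuhlmann 2005, Thm. 2.1 (`x, y` are then algebraically independent, `vK(x,y) = vK ⊕ ⊕ ℤvxᵢ`,
`K(x,y)P = KP(yP)`) this says `ρ + τ = trdeg(F|K)`, i.e. equality in the inequality.
[cite: KnafKuhlmann2005, Section 1 (inequality (1)) and Thm. 2.1] -/
def IsAbhyankarPlace (V : ValuationSubring Ω) (K F : Subfield Ω) : Prop :=
  ∃ (ρ τ : ℕ) (x : Fin ρ → Ω) (y : Fin τ → Ω) (hy : ∀ j, y j ∈ V),
    (∀ i, x i ∈ F ∧ x i ≠ 0) ∧ (∀ j, y j ∈ F) ∧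
    (∀ m : Fin ρ → ℤ, (∃ b ∈ K, (∏ i, V.valuation (x i) ^ (m i)) = V.valuation b) → m = 0) ∧
    AlgebraicIndependent (resField V K) (fun j => residue V ⟨y j, hy j⟩) ∧
    ∀ z ∈ F, IsAlgebraic (IntermediateField.adjoin K (Set.range x ∪ Set.range y)) z

/-! ## Smoothly uniformizable pairs, ambient form -/

/-- **Smoothly `R`-uniformizable pair, ambient form** (Knaf–Kuhlmann 2009, §1 p. 2: "there
exists an `R`-model `X` of `F|K` such that `X → Spec R` is smooth at the center `x ∈ X` of `P`
on `X` and `Z` is contained in the local ring `O_{X,x}`"; §3.1 p. 14: affine models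
`X = Spec A`, `A ⊂ F` finitely presented over `R`, suffice). For a subfield `E ⊆ Ω` valued by
`V ∩ E`: an `R`-subalgebra `A ⊆ V ∩ E` of `Ω`, finitely presented over `R`, with `Frac A = E`
(every element of `E` is a quotient of elements of `A`), smooth over `R` at the centre
`𝔪_V ∩ A` (`Algebra.IsSmoothAt`, cf. `SmoothUniformization.lean`), and `Z ⊆ A_{𝔪_V ∩ A}`. The
twin of `IsSmoothlyUniformizable` for subfields of an ambient valued field.
[cite: KnafKuhlmann2009, Section 1 (p. 2) and Section 3.1 (p. 14)] -/
def IsSmoothlyUniformizableIn (R : Type*) [CommRing R] [Algebra R Ω] (V : ValuationSubring Ω)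
    (E : Subfield Ω) (Z : Set Ω) : Prop :=
  ∃ (A : Subalgebra R Ω) (hAV : A.toSubring ≤ V.toSubring), (A : Set Ω) ⊆ E ∧
    Algebra.FinitePresentation R A ∧ (∀ x ∈ E, ∃ a ∈ A, ∃ b ∈ A, x = a / b) ∧
    Algebra.IsSmoothAt R (centre A V hAV) ∧
    ∀ z ∈ Z, ∃ a ∈ A, ∃ b ∈ A, V.valuation b = 1 ∧ z = a / b

/-! ## API -/

/-- Shrinking `Z` preserves smooth uniformizability. [folklore] -/
theorem IsSmoothlyUniformizableIn.mono {R : Type*} [CommRing R] [Algebra R Ω]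
    {V : ValuationSubring Ω} {E : Subfield Ω} {Z Z' : Set Ω} (hZ : Z' ⊆ Z)
    (h : IsSmoothlyUniformizableIn R V E Z) : IsSmoothlyUniformizableIn R V E Z' := by
  obtain ⟨A, hAV, hAE, hfp, hfrac, hsm, hZA⟩ := h
  exact ⟨A, hAV, hAE, hfp, hfrac, hsm, fun z hz => hZA z (hZ hz)⟩

/-- A model of `E` over `R` contains the image of `R`; in particular `R` maps into `V ∩ E`.
[folklore] -/
theorem IsSmoothlyUniformizableIn.algebraMap_mem {R : Type*} [CommRing R] [Algebra R Ω]
    {V : ValuationSubring Ω} {E : Subfield Ω} {Z : Set Ω}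
    (h : IsSmoothlyUniformizableIn R V E Z) (r : R) :
    algebraMap R Ω r ∈ V ∧ algebraMap R Ω r ∈ E := by
  obtain ⟨A, hAV, hAE, -, -, -, -⟩ := h
  exact ⟨hAV (A.algebraMap_mem r), hAE (A.algebraMap_mem r)⟩

/-- `vF/vK` torsion is transitive in towers `K ≤ F ≤ L`. [folklore] -/
theorem IsValueTorsionOver.trans {V : ValuationSubring Ω} {K F L : Subfield Ω}
    (hKF : IsValueTorsionOver V K F) (hFL : IsValueTorsionOver V F L) :
    IsValueTorsionOver V K L := by
  intro a ha ha0
  obtain ⟨n, hn, b, hbF, hb⟩ := hFL a ha ha0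
  by_cases hb0 : b = 0
  · -- then `a ^ n = 0`, impossible
    exfalso
    rw [hb0, map_zero, map_pow, pow_eq_zero_iff hn, map_eq_zero] at hb
    exact ha0 hb
  obtain ⟨m, hm, c, hcK, hc⟩ := hKF b hbF hb0
  refine ⟨n * m, mul_ne_zero hn hm, c, hcK, ?_⟩
  rw [pow_mul, map_pow, hb, ← map_pow, hc]

/-- The values of `K` lie in `vK`: `IsValueTorsionOver` is reflexive. [folklore] -/
theorem IsValueTorsionOver.refl (V : ValuationSubring Ω) (K : Subfield Ω) :
    IsValueTorsionOver V K K :=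
  fun a ha _ => ⟨1, one_ne_zero, a, ha, by rw [pow_one]⟩

end Literature.AlgebraicGeometry.Resolution

end
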